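import Summits.ResolutionOfSingularities.ResolutionOfSingularities.Theorems.WildConesCampaignW46HypersurfacesCharTwoThreeTangentsClosed
import Summits.ResolutionOfSingularities.ResolutionOfSingularities.Theorems.WildConesCampaignW46HypersurfacesCharTwoHilbertWitness
import Mathlib.FieldTheory.IsSepClosed

/-!
# [OURS · L1 W4.6, rung (ii) at p = 2, EVERY dimension n] SEPARABLY CLOSED FIELDS SUFFICE: over a separably closed
# field of characteristic 2 every corank ≥ 2 double point of `z² = a(u₁,…,uₙ)` HAS an infinitely-near double point,
# the three-tangents class `(e, h₂) = (2, 1)` has EXACTLY THREE, and for `n ≥ 3` an isolated double point is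
# resolved by ONE point blow-up if and only if `μ ≤ 2`

HONEST FRAMING. Everything here is OURS: theorems about route WildCones' own TYPED point-blow-up dynamics
(`Theorems/WildConesClassicalRegimesDefs.lean`) and the seat's invariants `polarMatrix` (p502936),
`milnorEmbDim` (p498937), `milnorHilbertTwo` (p511581), `degForm` (p522667). NOTHING here is a statement of the
manuscript [Hironaka2017]; no FACT-LIST premise; AI review is weaker than expert review. Cell res-hironaka
(LADDER-RESOLUTION rung L, D-0089), slot W4.6, seat res-L1-s46-pv-4 (gen 7); host route `WildCones`, crux
`ClassicalRegimes` (stmt-ResolutionOfSingularities-16884; proved).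

THE POINT. p557052 used an ALGEBRAICALLY closed field twice: a root of the kernel cubic along a line (degree `3`),
and a root of the quadratic next to a free near point. In characteristic `2` both roots are SEPARABLE phenomena:
(1) over a separably closed field `k` of characteristic `p`, every polynomial whose degree is NOT divisible by `p`
has a root in `k` (an irreducible factor is separable — hence linear — or is `g₁(X^p)`, of degree divisible by `p`;
peel it off and recurse), so a genuine cubic has a root in characteristic `2`; (2) next to a near vector `w₁` which
is NOT A NULL POLAR the kernel cubic along `x ↦ v + x·w₁` is `polar(v,w₁)·x² + polar(w₁,v)·x + a₃(v)` with LINEAR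
coefficient `polar(w₁, v) ≠ 0` — an Artin–Schreier-type equation, solvable over a separably closed field
(`IsSepClosed.exists_root_C_mul_X_pow_add_C_mul_X_add_C'`). At `h₂ = 1` no near vector is a null polar (`N = 0`,
p542945), so the `D₄` configuration of EXACTLY THREE free near points is already rational over the separable
closure — the infinitely-near double points are étale-local data. (At `(2,2)` the free point IS the null polar,
gen 7's `…NullPolarNear`, and the second root — the satellite — is a square root, genuinely inseparable.)
Consequence, with gen 3 (`e ≤ 1`) and `μ ≥ e + 1` (p517132): over a separably closed field of characteristic `2`,
for `n ≥ 3`, an isolated double point has NO infinitely-near double point iff `μ ≤ 2` (`μ = 1`: `e = 0`;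
`μ = 2`: `e = 1` with `a₃ ≠ 0` at the kernel point; `μ ≥ 3` forces `e ≥ 2` or `e = 1, μ ≥ 4`, and a near point).

WHAT IS PROVED (every `n`; `κ` separably closed of characteristic `2` where marked):

* `exists_root_of_not_dvd_natDegree` — `k` separably closed of prime characteristic `p`, `p ∤ deg P` ⇒ `P` has a
  root in `k`; `exists_root_cubic_of_isSepClosed` — characteristic `2`: `ax³ + bx² + cx + d = 0` (`a ≠ 0`) is
  solvable;
* `exists_kernel_pair_of_two_le` — `e ≥ 2`: two non-proportional kernel vectors (any field);
* `hypersurface_exists_near_of_isSepClosed`, `hypersurface_exists_double_successor_of_isSepClosed` — sep. closed,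
  `e ≥ 2`: a non-zero kernel vector on the tangent cubic; (isolated) a double successor EXISTS;
* `hypersurface_exists_second_near_of_not_null_of_isSepClosed` — sep. closed, `e = 2`: next to a near vector that
  is not a null polar there is a near vector off its line (no freeness needed);
* `hypersurface_three_near_points_of_isSepClosed` — **sep. closed, isolated `(e, h₂) = (2, 1)` ⇒ THREE double
  successors of corank `0` with pairwise non-proportional near vectors** (with p543928: exactly three);
* `hypersurface_resolved_in_one_iff_mu_le_two_of_isSepClosed` — **sep. closed, `n ≥ 3`, isolated double state:
  no double successor at all ⟺ `μ ≤ 2`**; `hypersurface_exists_double_successor_of_three_le_mu_of_isSepClosed`.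

References: [CasasAlvero2000] §3 (context only); [GreuelPfister2026] (context); [Hironaka2017] Th. 16.6 p.84 —
role replaced only, under adjudication; nothing of it is used.
-/

noncomputable section

-- single-problem summit: the doubled namespace component `ResolutionOfSingularities` is forced
set_option linter.dupNamespace false

open scoped BigOperators Classical

open MvPowerSeries IsLocalRing

open Literature.AlgebraicGeometry.Resolution

namespace Summit.ResolutionOfSingularities.ResolutionOfSingularities.Theorems

namespace CampaignW46.HypersurfacesCharTwo

open WildCones WildCones.MuDropCharTwoOrdP ThreefoldsCharTwo

variable {κ : Type} [Field κ] {n : ℕ}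

/-! ## Polynomials of degree prime to the characteristic over a separably closed field -/

/-- [OURS · L1 W4.6] **Over a separably closed field of prime characteristic `p`, a polynomial whose degree is
not divisible by `p` has a root.** (An irreducible factor `g` of `P` is either separable — then linear, since the
field is separably closed — or of the form `g₁(X^p)`, of degree divisible by `p`; in the latter case the cofactor
has smaller degree, still not divisible by `p`: induct.) [folklore] -/
theorem exists_root_of_not_dvd_natDegree {k : Type*} [Field k] [IsSepClosed k] (p : ℕ) [Fact p.Prime]
    [CharP k p] {P : Polynomial k} (h : ¬ p ∣ P.natDegree) : ∃ x : k, P.IsRoot x := by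
  induction hN : P.natDegree using Nat.strong_induction_on generalizing P with
  | _ N ih =>
    have hdeg : P.natDegree ≠ 0 := fun h0 => h (h0 ▸ dvd_zero p)
    have hP0 : P ≠ 0 := fun h0 => hdeg (by rw [h0, Polynomial.natDegree_zero])
    have hPu : ¬IsUnit P := fun hu => hdeg (Polynomial.natDegree_eq_zero_of_isUnit hu)
    obtain ⟨g, hg, q, hgq⟩ := WfDvdMonoid.exists_irreducible_factor hPu hP0
    have hg0 : g ≠ 0 := hg.ne_zero
    have hq0 : q ≠ 0 := fun h0 => hP0 (by rw [hgq, h0, mul_zero])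
    rcases Polynomial.separable_or p hg with hsep | ⟨-, g₁, -, hgg⟩
    · obtain ⟨x, hx⟩ :=
        Polynomial.exists_root_of_degree_eq_one (IsSepClosed.degree_eq_one_of_irreducible k hg hsep)
      refine ⟨x, ?_⟩
      rw [Polynomial.IsRoot.def, hgq, Polynomial.eval_mul, hx.eq_zero, zero_mul]
    · have hdg : g.natDegree = g₁.natDegree * p := by rw [← hgg, Polynomial.natDegree_expand]
      have hmul : P.natDegree = g.natDegree + q.natDegree := by
        rw [hgq]; exact Polynomial.natDegree_mul hg0 hq0
      have hgpos : 0 < g.natDegree :=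
        Polynomial.natDegree_pos_iff_degree_pos.mpr (Polynomial.degree_pos_of_irreducible hg)
      have hq : ¬ p ∣ q.natDegree := fun hdvd =>
        h (by rw [hmul, hdg]; exact dvd_add (dvd_mul_left p _) hdvd)
      have hlt : q.natDegree < N := by rw [← hN, hmul]; omega
      obtain ⟨x, hx⟩ := ih q.natDegree hlt hq rfl
      refine ⟨x, ?_⟩
      rw [Polynomial.IsRoot.def, hgq, Polynomial.eval_mul, hx.eq_zero, mul_zero]

/-- [OURS · L1 W4.6] **A genuine cubic has a root over a separably closed field of characteristic two**:
`a ≠ 0` ⇒ `a x³ + b x² + c x + d = 0` for some `x` (degree `3` is odd). [folklore] -/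
theorem exists_root_cubic_of_isSepClosed [CharP κ 2] [IsSepClosed κ] {a : κ} (ha : a ≠ 0) (b c d : κ) :
    ∃ x : κ, a * x ^ 3 + b * x ^ 2 + c * x + d = 0 := by
  haveI : Fact (Nat.Prime 2) := ⟨Nat.prime_two⟩
  set P : Polynomial κ := Polynomial.C a * Polynomial.X ^ 3 + Polynomial.C b * Polynomial.X ^ 2 +
    Polynomial.C c * Polynomial.X + Polynomial.C d with hP
  have hdeg : P.natDegree = 3 := by rw [hP]; exact Polynomial.natDegree_cubic ha
  obtain ⟨x, hx⟩ := exists_root_of_not_dvd_natDegree (P := P) 2 (by rw [hdeg]; decide)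
  refine ⟨x, ?_⟩
  rw [Polynomial.IsRoot.def, hP] at hx
  simpa only [Polynomial.eval_add, Polynomial.eval_mul, Polynomial.eval_C, Polynomial.eval_pow,
    Polynomial.eval_X] using hx

/-! ## Two kernel directions in corank `≥ 2` -/

/-- [OURS · L1 W4.6] In corank `e ≥ 2` there are two non-proportional kernel vectors of the polar form (any
field of characteristic `2`; the kernel has dimension `e`, p503790). [folklore] -/
theorem exists_kernel_pair_of_two_le [CharP κ 2] {c : (Fin n → ℕ) → κ} (hM : MultP 2 n κ c)
    (he : 2 ≤ milnorEmbDim 2 n κ c) :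
    ∃ v₁ v₂ : Fin n → κ, v₁ ≠ 0 ∧ Matrix.vecMul v₁ (polarMatrix (ser 2 n κ c)) = 0 ∧
      Matrix.vecMul v₂ (polarMatrix (ser 2 n κ c)) = 0 ∧ ∀ r : κ, v₂ ≠ r • v₁ := by
  set K := LinearMap.ker (polarMatrix (ser 2 n κ c)).mulVecLin with hK
  have hfr : 2 ≤ Module.finrank κ K := by rw [hK, finrank_ker_polarMatrix hM]; exact he
  have hne : K ≠ ⊥ := by
    intro h
    rw [h, finrank_bot] at hfr
    exact absurd hfr (by norm_num)
  obtain ⟨v₁, hv₁K, hv₁0⟩ := Submodule.exists_mem_ne_zero_of_ne_bot hne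
  have hL : (κ ∙ v₁) < K := by
    refine lt_of_le_of_ne ((Submodule.span_singleton_le_iff_mem v₁ K).mpr hv₁K) (fun hEq => ?_)
    have h1 := finrank_span_singleton (K := κ) hv₁0
    rw [hEq] at h1
    omega
  obtain ⟨v₂, hv₂K, hv₂L⟩ := SetLike.exists_of_lt hL
  exact ⟨v₁, v₂, hv₁0, (mem_ker_polarMatrix_iff _ _).mp hv₁K, (mem_ker_polarMatrix_iff _ _).mp hv₂K,
    fun r hr => hv₂L (Submodule.mem_span_singleton.mpr ⟨r, hr.symm⟩)⟩

/-! ## A near point exists in corank `≥ 2` over a separably closed field -/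

/-- [OURS · L1 W4.6 rung (ii) at `p = 2`, every dimension, SEPARABLY CLOSED field; NOT a statement of the
manuscript] **IN CORANK `≥ 2` A NEAR POINT EXISTS over a separably closed field of characteristic `2`**: some
non-zero kernel vector of the polar form lies on the tangent cubic (with kernel vectors `v₁ ∉ κv₂`… : `[v₁]` if
`a₃(v₁) = 0`, else a root of the genuine cubic `x ↦ a₃(v₂ + xv₁)`, which exists since `3` is odd).
[folklore] -/
theorem hypersurface_exists_near_of_isSepClosed [CharP κ 2] [IsSepClosed κ] (c : (Fin n → ℕ) → κ)
    (hM : MultP 2 n κ c) (he : 2 ≤ milnorEmbDim 2 n κ c) :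
    ∃ w : Fin n → κ, w ≠ 0 ∧ Matrix.vecMul w (polarMatrix (ser 2 n κ c)) = 0 ∧ degForm 3 (ser 2 n κ c) w = 0 := by
  set f := ser 2 n κ c with hfdef
  obtain ⟨v₁, v₂, hv₁0, hv₁, hv₂, hnot⟩ := exists_kernel_pair_of_two_le hM he
  by_cases ha : degForm 3 f v₁ = 0
  · exact ⟨v₁, hv₁0, hv₁, ha⟩
  obtain ⟨x₀, hx₀⟩ := exists_root_cubic_of_isSepClosed ha
    (∑ s, v₂ s * degForm 2 (MvPowerSeries.pderiv s f) v₁) (∑ s, v₁ s * degForm 2 (MvPowerSeries.pderiv s f) v₂)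
    (degForm 3 f v₂)
  have heval : degForm 3 f (v₂ + x₀ • v₁) = 0 := by
    rw [degForm_three_add_smul]
    linear_combination hx₀
  refine ⟨v₂ + x₀ • v₁, fun h0 => hnot (-x₀) ?_, ?_, heval⟩
  · rw [neg_smul]
    exact eq_neg_of_add_eq_zero_left h0
  · rw [Matrix.add_vecMul, Matrix.smul_vecMul, hv₁, hv₂, smul_zero, add_zero]

/-- [OURS · L1 W4.6 rung (ii) at `p = 2`, every dimension, separably closed field; NOT a statement of the
manuscript] Hence an ISOLATED double point of corank `e ≥ 2` over a separably closed field of characteristic `2`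
always HAS an infinitely-near double point (for `e ≥ 3` or `(e, h₂) = (2, 3)` a non-isolated one, gen 4).
[folklore] -/
theorem hypersurface_exists_double_successor_of_isSepClosed [CharP κ 2] [IsSepClosed κ] (c : (Fin n → ℕ) → κ)
    (hM : MultP 2 n κ c) (hI : Isol 2 n κ c) (he : 2 ≤ milnorEmbDim 2 n κ c) :
    ∃ (i : Fin n) (τ : Fin n → κ), MultP 2 n κ (step 2 n κ i τ c) := by
  obtain ⟨w, hw0, hw, hcub⟩ := hypersurface_exists_near_of_isSepClosed c hM he
  exact hypersurface_exists_double_successor_of_kernel_root c hM hI hw0 hw hcub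

/-! ## A second near point next to one that is not a null polar -/

/-- [OURS · L1 W4.6 rung (ii) at `p = 2`, every dimension, SEPARABLY CLOSED field; NOT a statement of the
manuscript] **NEXT TO A NEAR POINT WHICH IS NOT A NULL POLAR THERE IS A SECOND NEAR POINT** (corank two,
separably closed field of characteristic `2`): if `w₁ ≠ 0` is a kernel vector on the tangent cubic whose polar does
NOT vanish on the kernel, then some kernel vector on the cubic is NOT a multiple of `w₁` — along `x ↦ a₃(v + xw₁)`
the cubic coefficient `a₃(w₁)` vanishes and the LINEAR one, `polar(w₁, v)`, does not (else `polar(w₁, ·)` would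
vanish on `K = ⟨w₁, v⟩` by `polar(w₁, αw₁ + βv) = α²a₃(w₁) + β²polar(w₁, v)`), so the equation is separable.
Freeness of `w₁` is not needed. [folklore] -/
theorem hypersurface_exists_second_near_of_not_null_of_isSepClosed [CharP κ 2] [IsSepClosed κ]
    (c : (Fin n → ℕ) → κ) (hM : MultP 2 n κ c) (he : milnorEmbDim 2 n κ c = 2) {w₁ : Fin n → κ}
    (hw₁0 : w₁ ≠ 0) (hw₁ : Matrix.vecMul w₁ (polarMatrix (ser 2 n κ c)) = 0)
    (hc₁ : degForm 3 (ser 2 n κ c) w₁ = 0)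
    (hnn : ∃ u : Fin n → κ, Matrix.vecMul u (polarMatrix (ser 2 n κ c)) = 0 ∧
      ∑ s, w₁ s * degForm 2 (MvPowerSeries.pderiv s (ser 2 n κ c)) u ≠ 0) :
    ∃ w₂ : Fin n → κ, Matrix.vecMul w₂ (polarMatrix (ser 2 n κ c)) = 0 ∧ degForm 3 (ser 2 n κ c) w₂ = 0 ∧
      ∀ r : κ, w₂ ≠ r • w₁ := by
  set f := ser 2 n κ c with hfdef
  obtain ⟨v, hv, hnot, -⟩ := exists_kernel_pair hM he hw₁0 hw₁
  have hd₁ : ∑ s, w₁ s * degForm 2 (MvPowerSeries.pderiv s f) w₁ = 0 := by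
    rw [← degForm_three_eq_polar_self]; exact hc₁
  -- the linear coefficient `polar(w₁, v)` is non-zero
  have hb : ∑ s, w₁ s * degForm 2 (MvPowerSeries.pderiv s f) v ≠ 0 := by
    intro h0
    obtain ⟨u, hu, hne⟩ := hnn
    obtain ⟨α, β, hαβ⟩ := kernel_span_pair hM he hw₁0 hw₁ hv hnot u hu
    rw [← hαβ, polar_self_add, hd₁, h0, mul_zero, mul_zero, add_zero] at hne
    exact hne rfl
  obtain ⟨x₀, hx₀⟩ := IsSepClosed.exists_root_C_mul_X_pow_add_C_mul_X_add_C' 2 2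
    (∑ s, v s * degForm 2 (MvPowerSeries.pderiv s f) w₁) (∑ s, w₁ s * degForm 2 (MvPowerSeries.pderiv s f) v)
    (degForm 3 f v) (dvd_refl 2) le_rfl hb
  have heval : degForm 3 f (v + x₀ • w₁) = 0 := by
    rw [degForm_three_add_smul, hc₁, mul_zero, add_zero]
    linear_combination hx₀
  refine ⟨v + x₀ • w₁, ?_, heval, fun r h => hnot (r - x₀) ?_⟩
  · rw [Matrix.add_vecMul, Matrix.smul_vecMul, hw₁, hv, smul_zero, add_zero]
  · rw [sub_smul, ← h, add_sub_cancel_right]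

/-! ## Exactly three at `h₂ = 1` over a separably closed field -/

/-- [OURS · L1 W4.6] At `h₂ = 1` (`e = 2`) no non-zero kernel vector is a null polar (`N = 0`, p542945): the
polar of a non-zero kernel vector is non-zero at some kernel vector. [folklore] -/
theorem hypersurface_not_null_of_milnorHilbertTwo_eq_one [CharP κ 2] (c : (Fin n → ℕ) → κ) (hM : MultP 2 n κ c)
    (he : milnorEmbDim 2 n κ c = 2) (hh : milnorHilbertTwo 2 n κ c = 1) {w : Fin n → κ} (hw0 : w ≠ 0)
    (hw : Matrix.vecMul w (polarMatrix (ser 2 n κ c)) = 0) :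
    ∃ u : Fin n → κ, Matrix.vecMul u (polarMatrix (ser 2 n κ c)) = 0 ∧
      ∑ s, w s * degForm 2 (MvPowerSeries.pderiv s (ser 2 n κ c)) u ≠ 0 := by
  by_contra h
  push Not at h
  exact hw0 ((hypersurface_milnorHilbertTwo_eq_one_iff_no_null_polar c hM he).mp hh w hw h)

/-- [OURS · L1 W4.6 rung (ii) at `p = 2`, EVERY dimension `n`, SEPARABLY CLOSED field of characteristic `2`; NOT
a statement of the manuscript] **THE THREE-TANGENTS CLASS HAS EXACTLY THREE INFINITELY-NEAR DOUBLE POINTS over a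
separably closed field**: an isolated double state of `z² = a(u₁,…,uₙ)` with `e(c) = 2`, `h₂(c) = 1` has three
charts/translations giving double successors of corank `0` (free: isolated, `μ = 1`, nothing after) whose near
vectors are pairwise non-proportional; by the census (p543928) every near vector is a multiple of one of them.
(A near point exists — odd degree; at `h₂ = 1` it is free (gen 4) and not a null polar (`N = 0`); next to it a
second — separable quadratic; two free points give a third, p555329.) The algebraically-closed hypothesis of
p557052 is weakened to separably closed: the `D₄` configuration is étale-local. [folklore] -/
theorem hypersurface_three_near_points_of_isSepClosed [CharP κ 2] [IsSepClosed κ] (c : (Fin n → ℕ) → κ)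
    (hM : MultP 2 n κ c) (hI : Isol 2 n κ c) (he : milnorEmbDim 2 n κ c = 2) (hh : milnorHilbertTwo 2 n κ c = 1) :
    ∃ (i₁ i₂ i₃ : Fin n) (τ₁ τ₂ τ₃ : Fin n → κ),
      (MultP 2 n κ (step 2 n κ i₁ τ₁ c) ∧ milnorEmbDim 2 n κ (step 2 n κ i₁ τ₁ c) = 0) ∧
      (MultP 2 n κ (step 2 n κ i₂ τ₂ c) ∧ milnorEmbDim 2 n κ (step 2 n κ i₂ τ₂ c) = 0) ∧
      (MultP 2 n κ (step 2 n κ i₃ τ₃ c) ∧ milnorEmbDim 2 n κ (step 2 n κ i₃ τ₃ c) = 0) ∧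
      (∀ r : κ, Function.update τ₂ i₂ 1 ≠ r • Function.update τ₁ i₁ 1) ∧
      (∀ r : κ, Function.update τ₃ i₃ 1 ≠ r • Function.update τ₁ i₁ 1) ∧
      (∀ r : κ, Function.update τ₃ i₃ 1 ≠ r • Function.update τ₂ i₂ 1) := by
  -- every double successor is free at `h₂ = 1`
  have hfree : ∀ (i : Fin n) (τ : Fin n → κ), MultP 2 n κ (step 2 n κ i τ c) →
      milnorEmbDim 2 n κ (step 2 n κ i τ c) = 0 :=
    fun i τ hM' => (hypersurface_regime_step_of_milnorHilbertTwo_eq_one c i τ hM he hh hM').1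
  -- a first near point
  obtain ⟨w₁, hw₁0, hk₁, hc₁⟩ := hypersurface_exists_near_of_isSepClosed c hM (by omega)
  obtain ⟨i₁, hi₁⟩ : ∃ i, w₁ i ≠ 0 := by
    by_contra h
    push Not at h
    exact hw₁0 (funext h)
  have hM₁ := hypersurface_multP_step_of_vec c hM hI hi₁ hk₁ hc₁
  have he₁ := hfree i₁ _ hM₁
  -- it is free, as a vector
  have hf₁ : ∃ v : Fin n → κ, Matrix.vecMul v (polarMatrix (ser 2 n κ c)) = 0 ∧
      ∑ s, v s * degForm 2 (MvPowerSeries.pderiv s (ser 2 n κ c)) w₁ ≠ 0 := by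
    obtain ⟨v, hv, hne⟩ := (hypersurface_milnorEmbDim_step_eq_zero_iff c i₁ _ hM he hM₁).mp he₁
    rw [update_inv_smul_eq hi₁, polar_smul_right] at hne
    exact ⟨v, hv, fun h0 => hne (by rw [h0, mul_zero])⟩
  -- a second near point, off the line of the first (the first is not a null polar: `N = 0`)
  obtain ⟨w₂, hk₂, hc₂, hnot⟩ := hypersurface_exists_second_near_of_not_null_of_isSepClosed c hM he hw₁0 hk₁ hc₁
    (hypersurface_not_null_of_milnorHilbertTwo_eq_one c hM he hh hw₁0 hk₁)
  have hw₂0 : w₂ ≠ 0 := fun h0 => hnot 0 (by rw [h0, zero_smul])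
  obtain ⟨i₂, hi₂⟩ : ∃ i, w₂ i ≠ 0 := by
    by_contra h
    push Not at h
    exact hw₂0 (funext h)
  have hM₂ := hypersurface_multP_step_of_vec c hM hI hi₂ hk₂ hc₂
  have he₂ := hfree i₂ _ hM₂
  have hf₂ : ∃ v : Fin n → κ, Matrix.vecMul v (polarMatrix (ser 2 n κ c)) = 0 ∧
      ∑ s, v s * degForm 2 (MvPowerSeries.pderiv s (ser 2 n κ c)) w₂ ≠ 0 := by
    obtain ⟨v, hv, hne⟩ := (hypersurface_milnorEmbDim_step_eq_zero_iff c i₂ _ hM he hM₂).mp he₂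
    rw [update_inv_smul_eq hi₂, polar_smul_right] at hne
    exact ⟨v, hv, fun h0 => hne (by rw [h0, mul_zero])⟩
  -- the third
  obtain ⟨i₃, τ₃, hM₃, he₃, hn₁, hn₂⟩ :=
    hypersurface_third_free_point c hM hI he hw₁0 hk₁ hk₂ hnot hc₁ hc₂ hf₁ hf₂
  refine ⟨i₁, i₂, i₃, (w₁ i₁)⁻¹ • w₁, (w₂ i₂)⁻¹ • w₂, τ₃, ⟨hM₁, he₁⟩, ⟨hM₂, he₂⟩, ⟨hM₃, he₃⟩, ?_, ?_, ?_⟩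
  · intro r h
    rw [update_inv_smul_eq hi₁, update_inv_smul_eq hi₂, smul_smul] at h
    apply hnot (w₂ i₂ * (r * (w₁ i₁)⁻¹))
    have := congrArg (fun z => w₂ i₂ • z) h
    simp only [smul_smul, mul_inv_cancel₀ hi₂, one_smul] at this
    exact this
  · intro r h
    rw [update_inv_smul_eq hi₁, smul_smul] at h
    exact hn₁ _ h
  · intro r h
    rw [update_inv_smul_eq hi₂, smul_smul] at h
    exact hn₂ _ h

/-! ## Resolved by one blow-up iff `μ ≤ 2` -/

/-- [OURS · L1 W4.6 rung (ii) at `p = 2`, every dimension `n ≥ 3`, SEPARABLY CLOSED field of characteristic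
`2`; NOT a statement of the manuscript] **AN ISOLATED DOUBLE POINT IS RESOLVED BY ONE POINT BLOW-UP IF AND ONLY IF
`μ ≤ 2`.** For an isolated double state of `z² = a(u₁,…,uₙ)`, `n ≥ 3`, over a separably closed field of
characteristic `2`: NO chart and translation gives a double successor ⟺ `μ(c) ≤ 2`. (`e = 0 ⟺ μ = 1`: never a
double successor, gen 3; `e = 1`: no double successor ⟺ `μ = 2`, p505045; `e ≥ 2`: `μ ≥ 3` (p517132) and a near
point exists, this file.) Over a non-closed field only `⇐` survives (`𝔽₂`: an irreducible kernel cubic).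
[folklore] -/
theorem hypersurface_resolved_in_one_iff_mu_le_two_of_isSepClosed [CharP κ 2] [IsSepClosed κ] (hn : 3 ≤ n)
    (c : (Fin n → ℕ) → κ) (hM : MultP 2 n κ c) (hI : Isol 2 n κ c) :
    (∀ (i : Fin n) (τ : Fin n → κ), ¬ MultP 2 n κ (step 2 n κ i τ c)) ↔ mu 2 n κ c ≤ 2 := by
  have hμ := milnorHilbertTwo_add_le_mu hM hI
  rcases Nat.lt_or_ge (milnorEmbDim 2 n κ c) 2 with hlt | hge
  · rcases Nat.lt_or_ge (milnorEmbDim 2 n κ c) 1 with h0 | h1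
    · have he0 : milnorEmbDim 2 n κ c = 0 := by omega
      have hμ1 := ((milnorEmbDim_eq_zero_iff hM).mp he0).2
      exact ⟨fun _ => by omega, fun _ i τ => hypersurface_not_multP_step_of_milnorEmbDim_eq_zero c hM he0 i τ⟩
    · have he1 : milnorEmbDim 2 n κ c = 1 := by omega
      rw [hypersurface_resolved_in_one_iff_mu_eq_two hn c hM hI he1]
      omega
  · constructor
    · intro hno
      obtain ⟨i, τ, hiτ⟩ := hypersurface_exists_double_successor_of_isSepClosed c hM hI hge
      exact absurd hiτ (hno i τ)
    · intro h2
      omega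

/-- [OURS · L1 W4.6 rung (ii) at `p = 2`, every dimension `n ≥ 3`, separably closed field of characteristic `2`;
NOT a statement of the manuscript] Equivalently: `μ ≥ 3` ⟺ some chart and translation gives a double successor —
over a separably closed field the Milnor number alone decides whether the point blow-up resolves the isolated
double point at once. [folklore] -/
theorem hypersurface_exists_double_successor_iff_three_le_mu_of_isSepClosed [CharP κ 2] [IsSepClosed κ]
    (hn : 3 ≤ n) (c : (Fin n → ℕ) → κ) (hM : MultP 2 n κ c) (hI : Isol 2 n κ c) :
    (∃ (i : Fin n) (τ : Fin n → κ), MultP 2 n κ (step 2 n κ i τ c)) ↔ 3 ≤ mu 2 n κ c := by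
  have h := hypersurface_resolved_in_one_iff_mu_le_two_of_isSepClosed hn c hM hI
  constructor
  · rintro ⟨i, τ, hiτ⟩
    by_contra hlt
    exact h.mpr (by omega) i τ hiτ
  · intro h3
    by_contra hno
    push Not at hno
    have := h.mp hno
    omega

end CampaignW46.HypersurfacesCharTwo

end Summit.ResolutionOfSingularities.ResolutionOfSingularities.Theorems

end
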